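import Mathlib.Topology.MetricSpace.HausdorffDistance
import Mathlib.Data.List.Chain

/-!
# NE9KernelGeometry — the GEOMETRY binder (G) of the kernel species (`NE9Lemma1KernelSpecies.KerData.Admissible.geom`)
# from the triangle inequality and ONE diameter letter, with print's «δ₁ = O(M⁻¹)» and the additive constant made explicit
# (cell `pub-balaban`, T4-DAG §2 node U3 / §6 NE9; swarm unit b2b-balaban-t4-ne9-formalise-leaf-09, generation 6;
# own-initiative micro-item «(G)-GEOM», journal CLAIM l.10351 — the (G)-twin of crew row (w24) «lattice sums (S)»)

HONEST FRAMING (T4-DAG PAGE 1).  Rung (B)+1 of the FINITE-VOLUME T⁴ programme — NOT infinite volume, NOT a mass gap, NOT the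
Clay problem.  NE9 (`T4OutputRate.NE9` ∧ `FadingMemory`) is a cell NEW ESTIMATE, NOT PRINTED, NOT discharged here; spine 0/9.
HONEST DEPENDENCY (cell line, verbatim): continuum YM on T⁴ ⇐ BetaPertH ∧ nine spine estimates (0/9 proved); BetaPertH ⇐ (D1)
∧ (D4) ∧ CAP+tail; G-an2-4 gates asym, D1 and NE2/3/4.  `FlowStep.BetaPertH`, (B), (B^μ) do not occur.  [I] = [Balaban1987RG1]
(CMP **109**) is quoted for TYPES only (ABSOLUTE RULE: nothing printed in the audited series is asserted).

WHERE THIS SITS.  The row owner's kernel species (`Support/NE9Lemma1KernelSpecies`, p214232; skeleton v1.3.6 ADDENDUM) carries,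
inside `KerData.Admissible`, the DISPLAYED geometry binder

  (G)  `∀ k y a x, ∀ p ∈ pts k y a, ∀ q ∈ pts k y a, δ₁·ρd (p0 X) p + δ₁·ρd p q ≤ δ₀·(dX X p + dX X q) + w·d(X) + w₀`

(`X = x.1` the source domain, `p0 X` a base point x₀ ∈ X, `ρd` = |· − ·| in ξ-units, `dX X p` = dist^{(ξ)}(X, p), `d` the tree
length d_j), read off [I] p. 286: *"exp(−κd_j(X) − δ₀dist^{(ξ)}(X,x) − δ₀dist^{(ξ)}(X,x₃)) … < … exp(−⅓κd_j(X) − δ₁|x−x₀| −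
δ₁|x₃−x|)"*, *"the decay rate is rather poor, δ₁ = O(M⁻¹), because of the factor with κd_j(X)"* (in print w = ⅔κ).  THIS FILE
shows that (G) is NOT an independent input: in any pseudometric space it follows from the TRIANGLE INEQUALITY once the point set
`S` of X (∋ x₀) has extent `≤ Δ` with `2δ₁Δ ≤ w·d + w₀` and `2δ₁ ≤ δ₀` (§1 `geom_of_extent`); and with the ONE geometric letter
«Δ_X ≤ cM·(d(X) + 1)» (the ξ-extent of a 𝐃_j-domain of tree length d_j(X) built from j-cubes of ξ-side O(M)) the explicit
choice `δ₁ := min (δ₀/2) (w/(2cM))`, `w₀ := w` does it (§2 `geom_letters`; «δ₁ = O(M⁻¹)» becomes `δ₁ ≤ w/(2cM)`).  §3 states the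
FAMILY form token-shaped like the `geom` field (`ρd := dist`, `dX X p := Metric.infDist p (S X)`), so that whoever instantiates
`KerData` on the cell's lattice model (crew row (w24): `Pt := Fin 4 → ℤ`, sup metric) writes `geom := geom_family …`.  §4 is
the elementary CHAIN LEMMA behind the letter: a linked chain of n + 1 pieces of extent ≤ D with consecutive gaps ≤ e has extent
≤ 2·(D + n·(D + e)) — a 𝐃_j-domain's cubes listed along a walk of its minimal tree form such a chain.

WHAT IS NOT CLAIMED.  Nothing printed is asserted or discharged: (K) (the p. 286 summand bound) and the level counts stay
displayed, (S) is crew row (w24)'s, the model's 𝐃_j-domains / ξ-metric / tree length d_j are O-NE9-1 (carver).  This module is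
Mathlib-only (imports NO species module), so it lands independently of p214232 and modifies nothing.
DISGUISE TEST: metric bookkeeping on one source domain; no history, no coupling, not NE9.

References (TYPES only): [Balaban1987RG1] T. Bałaban, *Renormalization group approach to lattice gauge field theories. I*,
CMP **109** (1987) 249–301, (4.22) and the display after it, p. 286.  Summits-side NEW work (LEAN PLACEMENT RULE); 0 sorry.
Value = one displayed binder of the second species reduced to a geometric letter, NOT summit progress.
-/

noncomputable section

namespace Summit.QuantumFields.BalabanUV.T4Continuum.NE9KernelGeometry

open Metric Set

variable {Pt : Type*} [PseudoMetricSpace Pt]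

/-! ## §1 (G) from the triangle inequality, for one source domain -/

/-- A base point of the point set `S` is within `infDist p S + Δ` of every point `p`, `Δ` the extent of `S`
(triangle inequality through the point of `S` nearest to `p`). [folklore] -/
theorem dist_base_le_infDist_add {S : Set Pt} {x₀ : Pt} {Δ : ℝ} (hx₀ : x₀ ∈ S)
    (hΔ : ∀ u ∈ S, ∀ v ∈ S, dist u v ≤ Δ) (p : Pt) : dist x₀ p ≤ infDist p S + Δ := by
  have h : dist x₀ p - Δ ≤ infDist p S := by
    refine (le_infDist ⟨x₀, hx₀⟩).2 fun y hy => ?_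
    have h1 : dist x₀ p ≤ dist x₀ y + dist y p := dist_triangle x₀ y p
    have h2 : dist x₀ y ≤ Δ := hΔ x₀ hx₀ y hy
    rw [dist_comm y p] at h1
    linarith
  linarith

/-- Two points are within `infDist p S + infDist q S + Δ` of each other, `Δ` the extent of the nonempty point set `S`
(triangle inequality through the two nearest points of `S`). [folklore] -/
theorem dist_le_infDist_add_infDist_add {S : Set Pt} {Δ : ℝ} (hS : S.Nonempty)
    (hΔ : ∀ u ∈ S, ∀ v ∈ S, dist u v ≤ Δ) (p q : Pt) : dist p q ≤ infDist p S + infDist q S + Δ := by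
  have h : dist p q - infDist q S - Δ ≤ infDist p S := by
    refine (le_infDist hS).2 fun y hy => ?_
    have h1 : dist p q ≤ dist p y + dist y q := dist_triangle p y q
    have h2 : dist y q ≤ infDist q S + Δ := dist_base_le_infDist_add hy hΔ q
    linarith
  linarith

/-- **(G) FROM THE TRIANGLE INEQUALITY** (one source domain): if the point set `S ∋ x₀` of the domain has extent `≤ Δ`,
`0 ≤ δ₁`, `2δ₁ ≤ δ₀` and `2δ₁Δ ≤ w·d + w₀`, then for all points `p, q`
`δ₁·dist x₀ p + δ₁·dist p q ≤ δ₀·(infDist p S + infDist q S) + w·d + w₀` — the shape of the kernel species' binder (G) read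
off [I] p. 286 (*"exp(−κd_j(X) − δ₀dist^{(ξ)}(X,x) − δ₀dist^{(ξ)}(X,x₃)) … exp(−⅓κd_j(X) − δ₁|x−x₀| − δ₁|x₃−x|)"*; TYPE only).
[cite: Balaban1987RG1, (4.22) p.286] -/
theorem geom_of_extent {S : Set Pt} {x₀ : Pt} {Δ δ₀ δ₁ w w₀ d : ℝ} (hx₀ : x₀ ∈ S)
    (hΔ : ∀ u ∈ S, ∀ v ∈ S, dist u v ≤ Δ) (hδ₁ : 0 ≤ δ₁) (hδ : 2 * δ₁ ≤ δ₀) (hw : 2 * δ₁ * Δ ≤ w * d + w₀)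
    (p q : Pt) : δ₁ * dist x₀ p + δ₁ * dist p q ≤ δ₀ * (infDist p S + infDist q S) + w * d + w₀ := by
  have h1 : δ₁ * dist x₀ p ≤ δ₁ * infDist p S + δ₁ * Δ := by
    have := mul_le_mul_of_nonneg_left (dist_base_le_infDist_add hx₀ hΔ p) hδ₁
    linarith [mul_add δ₁ (infDist p S) Δ]
  have h2 : δ₁ * dist p q ≤ δ₁ * infDist p S + δ₁ * infDist q S + δ₁ * Δ := by
    have := mul_le_mul_of_nonneg_left (dist_le_infDist_add_infDist_add ⟨x₀, hx₀⟩ hΔ p q) hδ₁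
    have e : δ₁ * (infDist p S + infDist q S + Δ) = δ₁ * infDist p S + δ₁ * infDist q S + δ₁ * Δ := by ring
    linarith
  have hp : 0 ≤ infDist p S := infDist_nonneg
  have hq : 0 ≤ infDist q S := infDist_nonneg
  have h3 : 2 * δ₁ * infDist p S ≤ δ₀ * infDist p S := mul_le_mul_of_nonneg_right hδ hp
  have h4 : δ₁ * infDist q S ≤ δ₀ * infDist q S := mul_le_mul_of_nonneg_right (by linarith) hq
  have e : δ₀ * (infDist p S + infDist q S) = δ₀ * infDist p S + δ₀ * infDist q S := mul_add _ _ _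
  linarith

/-! ## §2 Print's letters made exact: δ₁ := min (δ₀/2) (w/(2cM)), w₀ := w -/

/- The explicit decay letter of (G) is `δ₁ := min (δ₀/2) (w/(2·cM))` — print's *"δ₁ = O(M⁻¹), because of the factor
with κd_j(X)"* ([I] p. 286; `cM` ↔ O(M)·(ξ-side of a j-cube), `w` ↔ ⅔κ).  It is written out in every statement (no `def`, so
that the module stays on the kernel lane). -/

/-- `2·δ₁ ≤ δ₀`. [folklore] -/
theorem two_mul_delta1_le (δ₀ w cM : ℝ) : 2 * min (δ₀ / 2) (w / (2 * cM)) ≤ δ₀ := by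
  have : min (δ₀ / 2) (w / (2 * cM)) ≤ δ₀ / 2 := min_le_left _ _
  linarith

/-- `δ₁ ≤ w/(2cM)` («δ₁ = O(M⁻¹)», equality-free). [folklore] -/
theorem delta1_le_div (δ₀ w cM : ℝ) : min (δ₀ / 2) (w / (2 * cM)) ≤ w / (2 * cM) := min_le_right _ _

/-- `0 ≤ δ₁` for `0 ≤ δ₀`, `0 ≤ w`, `0 < cM`. [folklore] -/
theorem delta1_nonneg {δ₀ w cM : ℝ} (hδ₀ : 0 ≤ δ₀) (hw : 0 ≤ w) (hcM : 0 < cM) : 0 ≤ min (δ₀ / 2) (w / (2 * cM)) :=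
  le_min (by linarith) (div_nonneg hw (by linarith))

/-- `0 < δ₁` for `0 < δ₀`, `0 < w`, `0 < cM` (a genuine decay). [folklore] -/
theorem delta1_pos {δ₀ w cM : ℝ} (hδ₀ : 0 < δ₀) (hw : 0 < w) (hcM : 0 < cM) : 0 < min (δ₀ / 2) (w / (2 * cM)) :=
  lt_min (by linarith) (div_pos hw (by linarith))

/-- With the diameter letter `Δ ≤ cM·(d + 1)` (`0 ≤ d`), the choice `δ₁ := min (δ₀/2) (w/(2cM))`, `w₀ := w` satisfies the
budget `2δ₁Δ ≤ w·d + w` of `geom_of_extent`. [folklore] -/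
theorem two_mul_delta1_mul_le {δ₀ w cM Δ d : ℝ} (hδ₀ : 0 ≤ δ₀) (hw : 0 ≤ w) (hcM : 0 < cM) (hd : 0 ≤ d)
    (hΔ : Δ ≤ cM * (d + 1)) : 2 * min (δ₀ / 2) (w / (2 * cM)) * Δ ≤ w * d + w := by
  have h0 : 0 ≤ min (δ₀ / 2) (w / (2 * cM)) := delta1_nonneg hδ₀ hw hcM
  have h1 : 2 * min (δ₀ / 2) (w / (2 * cM)) * Δ ≤ 2 * min (δ₀ / 2) (w / (2 * cM)) * (cM * (d + 1)) :=
    mul_le_mul_of_nonneg_left hΔ (by linarith)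
  have h2 : 2 * min (δ₀ / 2) (w / (2 * cM)) * cM ≤ w := by
    have h := delta1_le_div δ₀ w cM
    have : min (δ₀ / 2) (w / (2 * cM)) * (2 * cM) ≤ w / (2 * cM) * (2 * cM) :=
      mul_le_mul_of_nonneg_right h (by linarith)
    rw [div_mul_cancel₀ w (by linarith : (2 * cM) ≠ 0)] at this
    linarith
  have h3 : 2 * min (δ₀ / 2) (w / (2 * cM)) * (cM * (d + 1)) = (2 * min (δ₀ / 2) (w / (2 * cM)) * cM) * (d + 1) := by
    ring
  have h4 : (2 * min (δ₀ / 2) (w / (2 * cM)) * cM) * (d + 1) ≤ w * (d + 1) :=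
    mul_le_mul_of_nonneg_right h2 (by linarith)
  linarith

/-- **(G) WITH PRINT'S LETTERS MADE EXACT**: for a source domain whose point set `S ∋ x₀` has extent `Δ ≤ cM·(d + 1)`
(`d ≥ 0` its tree length, `cM > 0`), and decay letters `δ₀ ≥ 0`, `w ≥ 0`, the binder (G) holds with
`δ₁ := min (δ₀/2) (w/(2cM))` and `w₀ := w`: `δ₁·dist x₀ p + δ₁·dist p q ≤ δ₀·(infDist p S + infDist q S) + w·d + w`.
[cite: Balaban1987RG1, (4.22) p.286] -/
theorem geom_letters {S : Set Pt} {x₀ : Pt} {Δ δ₀ w cM d : ℝ} (hx₀ : x₀ ∈ S) (hΔS : ∀ u ∈ S, ∀ v ∈ S, dist u v ≤ Δ)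
    (hδ₀ : 0 ≤ δ₀) (hw : 0 ≤ w) (hcM : 0 < cM) (hd : 0 ≤ d) (hΔ : Δ ≤ cM * (d + 1)) (p q : Pt) :
    min (δ₀ / 2) (w / (2 * cM)) * dist x₀ p + min (δ₀ / 2) (w / (2 * cM)) * dist p q ≤
      δ₀ * (infDist p S + infDist q S) + w * d + w :=
  geom_of_extent hx₀ hΔS (delta1_nonneg hδ₀ hw hcM) (two_mul_delta1_le δ₀ w cM)
    (two_mul_delta1_mul_le hδ₀ hw hcM hd hΔ) p q

/-! ## §3 The family form, token-shaped like `KerData.Admissible.geom` -/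

/-- **(G) FOR A FAMILY OF SOURCE DOMAINS** in the shape of the `geom` field of `NE9Lemma1KernelSpecies.KerData.Admissible` with
`ρd := dist`, `dX X p := infDist p (S X)`, base points `p0 X ∈ S X`: for index families `pts k y a` (any — the inequality holds
for all points), sources `x` with domain `x.1`, extents `Δ X` with `2δ₁·Δ X ≤ w·d X + w₀`, `0 ≤ δ₁`, `2δ₁ ≤ δ₀`.
[cite: Balaban1987RG1, (4.22) p.286] -/
theorem geom_family {Dom ι α τ : Type*} (pts : ℕ → ι → α → Finset Pt) (S : Dom → Set Pt) (p0 : Dom → Pt)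
    (d Δ : Dom → ℝ) {δ₀ δ₁ w w₀ : ℝ} (hp0 : ∀ X, p0 X ∈ S X) (hΔ : ∀ X, ∀ u ∈ S X, ∀ v ∈ S X, dist u v ≤ Δ X)
    (hδ₁ : 0 ≤ δ₁) (hδ : 2 * δ₁ ≤ δ₀) (hw : ∀ X, 2 * δ₁ * Δ X ≤ w * d X + w₀) :
    ∀ (k : ℕ) (y : ι) (a : α) (x : Dom × τ), ∀ p ∈ pts k y a, ∀ q ∈ pts k y a,
      δ₁ * dist (p0 x.1) p + δ₁ * dist p q ≤ δ₀ * (infDist p (S x.1) + infDist q (S x.1)) + w * d x.1 + w₀ :=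
  fun _ _ _ x p _ q _ => geom_of_extent (hp0 x.1) (hΔ x.1) hδ₁ hδ (hw x.1) p q

/-- The family form WITH PRINT'S LETTERS: extents `Δ X ≤ cM·(d X + 1)`, `0 ≤ d X`; then (G) holds for the whole family with
`δ₁ := min (δ₀/2) (w/(2cM))`, `w₀ := w`. [cite: Balaban1987RG1, (4.22) p.286] -/
theorem geom_family_letters {Dom ι α τ : Type*} (pts : ℕ → ι → α → Finset Pt) (S : Dom → Set Pt) (p0 : Dom → Pt)
    (d Δ : Dom → ℝ) {δ₀ w cM : ℝ} (hp0 : ∀ X, p0 X ∈ S X) (hΔS : ∀ X, ∀ u ∈ S X, ∀ v ∈ S X, dist u v ≤ Δ X)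
    (hδ₀ : 0 ≤ δ₀) (hw : 0 ≤ w) (hcM : 0 < cM) (hd : ∀ X, 0 ≤ d X) (hΔ : ∀ X, Δ X ≤ cM * (d X + 1)) :
    ∀ (k : ℕ) (y : ι) (a : α) (x : Dom × τ), ∀ p ∈ pts k y a, ∀ q ∈ pts k y a,
      min (δ₀ / 2) (w / (2 * cM)) * dist (p0 x.1) p + min (δ₀ / 2) (w / (2 * cM)) * dist p q ≤
        δ₀ * (infDist p (S x.1) + infDist q (S x.1)) + w * d x.1 + w :=
  geom_family pts S p0 d Δ hp0 hΔS (delta1_nonneg hδ₀ hw hcM) (two_mul_delta1_le δ₀ w cM)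
    fun X => two_mul_delta1_mul_le hδ₀ hw hcM (hd X) (hΔ X)

/-! ## §4 The chain lemma behind the diameter letter -/

/-- Distance from the HEAD piece along a linked chain: if `K :: l` is a chain of pieces of extent `≤ D` whose consecutive
members have points within `e` of each other, then every point of every member is within `D + |l|·(D + e)` of every point
of `K`. [folklore] -/
theorem dist_head_le_of_isChain {D e : ℝ} (hD : 0 ≤ D) (he : 0 ≤ e) :
    ∀ (K : Set Pt) (l : List (Set Pt)),
      List.IsChain (fun A B : Set Pt => ∃ u ∈ A, ∃ v ∈ B, dist u v ≤ e) (K :: l) →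
        (∀ A ∈ K :: l, ∀ u ∈ A, ∀ v ∈ A, dist u v ≤ D) →
          ∀ u ∈ K, ∀ A ∈ K :: l, ∀ v ∈ A, dist u v ≤ D + l.length * (D + e) := by
  intro K l
  induction l generalizing K with
  | nil =>
    intro _ hext u hu A hA v hv
    rw [List.mem_singleton] at hA
    subst hA
    simp only [List.length_nil, Nat.cast_zero, zero_mul, add_zero]
    exact hext _ (List.mem_singleton.2 rfl) u hu v hv
  | cons K' l ih =>
    intro hch hext u hu A hA v hv
    rw [List.isChain_cons_cons] at hch
    obtain ⟨⟨u₁, hu₁, v₁, hv₁, huv⟩, hch'⟩ := hch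
    have hlen : ((K' :: l).length : ℝ) = l.length + 1 := by simp
    have hext' : ∀ A ∈ K' :: l, ∀ u ∈ A, ∀ v ∈ A, dist u v ≤ D :=
      fun A hA => hext A (List.mem_cons_of_mem _ hA)
    have hnn : 0 ≤ (l.length : ℝ) * (D + e) := mul_nonneg (Nat.cast_nonneg _) (by linarith)
    rcases List.mem_cons.1 hA with hAK | hA'
    · subst hAK
      have h := hext _ (List.mem_cons_self) u hu v hv
      rw [hlen]
      nlinarith
    · have h1 : dist u u₁ ≤ D := hext _ (List.mem_cons_self) u hu u₁ hu₁
      have h2 : dist v₁ v ≤ D + l.length * (D + e) := ih K' hch' hext' v₁ hv₁ A hA' v hv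
      have h3 : dist u v ≤ dist u u₁ + dist u₁ v₁ + dist v₁ v := dist_triangle4 u u₁ v₁ v
      rw [hlen]
      nlinarith

/-- **THE CHAIN LEMMA** (the diameter letter of §2 from a covering chain): a linked chain `K :: l` of pieces of extent `≤ D`
with consecutive gaps `≤ e` has extent `≤ 2·(D + |l|·(D + e))` — any two points of its members are that close.  A 𝐃_j-domain's
j-cubes listed along a depth-first walk of its minimal tree form such a chain (D = e = the ξ-diameter of a j-cube = O(M),
|l| + 1 ≤ twice the number of tree edges + 1), which is the letter «Δ_X ≤ cM·(d_j(X) + 1)». [folklore] -/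
theorem extent_le_of_isChain {D e : ℝ} (hD : 0 ≤ D) (he : 0 ≤ e) {K : Set Pt} {l : List (Set Pt)}
    (hch : List.IsChain (fun A B : Set Pt => ∃ u ∈ A, ∃ v ∈ B, dist u v ≤ e) (K :: l))
    (hext : ∀ A ∈ K :: l, ∀ u ∈ A, ∀ v ∈ A, dist u v ≤ D) :
    ∀ A ∈ K :: l, ∀ u ∈ A, ∀ B ∈ K :: l, ∀ v ∈ B, dist u v ≤ 2 * (D + l.length * (D + e)) := by
  intro A hA u hu B hB v hv
  -- a point of the head piece: `u` itself if `A = K`, else the chain's first link provides one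
  have hK : ∃ u₀, u₀ ∈ K := by
    rcases List.mem_cons.1 hA with hAK | hA'
    · exact ⟨u, hAK ▸ hu⟩
    · cases l with
      | nil => exact absurd hA' List.not_mem_nil
      | cons K' l' =>
        rw [List.isChain_cons_cons] at hch
        obtain ⟨⟨u₀, hu₀, _⟩, _⟩ := hch
        exact ⟨u₀, hu₀⟩
  obtain ⟨u₀, hu₀⟩ := hK
  have h1 := dist_head_le_of_isChain hD he K l hch hext u₀ hu₀ A hA u hu
  have h2 := dist_head_le_of_isChain hD he K l hch hext u₀ hu₀ B hB v hv
  have h3 : dist u v ≤ dist u₀ u + dist u₀ v := dist_triangle_left u v u₀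
  linarith

/-- The chain lemma fed into (G): if the point set `S ∋ x₀` of the source domain is COVERED by a linked chain `K :: l` of pieces
of extent `≤ D` with gaps `≤ e` and `|l| ≤ n`, then (G) holds with any `0 ≤ δ₁`, `2δ₁ ≤ δ₀` and `w·d + w₀ ≥ 2δ₁·2·(D + n·(D +
e))`. [cite: Balaban1987RG1, (4.22) p.286] -/
theorem geom_of_isChain {D e : ℝ} (hD : 0 ≤ D) (he : 0 ≤ e) {S K : Set Pt} {l : List (Set Pt)} {x₀ : Pt} {n : ℕ}
    {δ₀ δ₁ w w₀ d : ℝ} (hx₀ : x₀ ∈ S) (hcov : ∀ u ∈ S, ∃ A ∈ K :: l, u ∈ A)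
    (hch : List.IsChain (fun A B : Set Pt => ∃ u ∈ A, ∃ v ∈ B, dist u v ≤ e) (K :: l))
    (hext : ∀ A ∈ K :: l, ∀ u ∈ A, ∀ v ∈ A, dist u v ≤ D) (hn : l.length ≤ n) (hδ₁ : 0 ≤ δ₁) (hδ : 2 * δ₁ ≤ δ₀)
    (hw : 2 * δ₁ * (2 * (D + n * (D + e))) ≤ w * d + w₀) (p q : Pt) :
    δ₁ * dist x₀ p + δ₁ * dist p q ≤ δ₀ * (infDist p S + infDist q S) + w * d + w₀ := by
  refine geom_of_extent hx₀ (fun u hu v hv => ?_) hδ₁ hδ hw p q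
  obtain ⟨A, hA, huA⟩ := hcov u hu
  obtain ⟨B, hB, hvB⟩ := hcov v hv
  have h := extent_le_of_isChain hD he hch hext A hA u huA B hB v hvB
  have hmono : (l.length : ℝ) * (D + e) ≤ (n : ℝ) * (D + e) :=
    mul_le_mul_of_nonneg_right (by exact_mod_cast hn) (by linarith)
  linarith

end Summit.QuantumFields.BalabanUV.T4Continuum.NE9KernelGeometry

end
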